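import Summits.BirchSwinnertonDyer.Rank1Residual.X11b.BDPRouteSurj
import Summits.BirchSwinnertonDyer.Rank1Residual.Partition.MainConjecturesAnticyclotomicClass
import Summits.BirchSwinnertonDyer.Rank1Residual.Supersingular.X6RankOneOneSided
import Literature.NumberTheory.EllipticCurves.RootNumberTwistSemistableProofs
import Literature.NumberTheory.EllipticCurves.RootNumberProofs
import Literature.NumberTheory.EllipticCurves.NoEverywhereGoodReductionRat
import HarnessLib

/-!
# Class X6 (good supersingular, semistable), analytic rank `1`, `p ≥ 5`: the LOWER half of `BSD(E,p)`
# from STEP L (anticyclotomic main conjecture + control + BDP, as typed) + Wuthrich's bound for the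
# Heegner twist — the kernel form of Jetchev–Skinner–Wan 2017 §7.4.1 at a SUPERSINGULAR prime; with
# Sprung 2024 Cor. 1.3 (ii) for the upper half, `BSD(E,p)` (cell `b2b-bsdres`, literature typer seat
# `lit-cw` = Castella–Wan / Wan-line papers, gen 3)

HONEST FRAMING (cell `b2b-bsdres`, run/shared/lean/b2b/bsd-rank1-residual/, verbatim in every
file): the goal of the cell is to DELETE the COMBINATION-SHAPED residual classes of the
Birch–Swinnerton-Dyer formula for ALL analytic-rank `≤ 1` elliptic curves over `ℚ` — "full BSD
formula for every rank `≤ 1` curve in class `C`" assembled STRICTLY from published theorems — so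
that the rank-`≤ 1` remainder becomes exactly the CONSTRUCTION-SHAPED classes, which are TYPED
(missing-input `Prop`s), NOT attempted. This is not "finishing BSD". Research routes; no claim
beyond stated classes. THEOREMS ONLY (no definition, no named fact); nothing about any curve is
asserted; nothing is booked; no label is moved by this file (the referee rules). NEW WORK of the
cell (compositions of decls already in the tree), hence under `Summits/`.

## What this file records (numbers/decls, not adjectives)

The class `ClassX6 W p := GoodSS W p ∧ Semistable W ∧ (5 ≤ p ∨ a_3 = 0)` in analytic rank `1`.
Its cover of record is Jetchev–Skinner–Wan, Camb. J. Math. 5 (2017) Thm. 1.2.1 (tree fact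
`JetchevSkinnerWan2017.thm121_padicValRat_bsd_rank_one`, `Typed.X6.bsdp_of_analyticRank_eq_one`),
tier PUB* under the census flag `JSW-ss` ("its supersingular case imports X. Wan's ± divisibility",
now Burungale–Skinner–Tian–Wan arXiv:2409.01350, a PREPRINT on 2026-08-20). Reading the printed
proof (arXiv:1512.06894 §1.3 pp. 4–5, §7.4 pp. 29–31; this seat's HOME/b2b-bsdres-lit-cw/CASTELLA-WAN.md
§0.7–§0.10; the status addendum of `JetchevSkinnerWan2017/RankOnePPart.lean`):

* §7.4.1 proves the LOWER bound (eq:shalower) `ord_p #Ш(E/ℚ)[p^∞] ≥ ord_p(L'(E,1)/(Ω·Reg·∏c_ℓ))`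
  from (α) the anticyclotomic divisibility §6.1 "Theorem ([wan:rankin], [wan:rankin-ss])" — at a
  supersingular `p` [wan:rankin-ss] = arXiv:1412.1767 is UNPUBLISHED; it was "completely re-written …
  as arXiv:2109.08375" = Castella–Liu–Wan, Forum Math. Sigma 10 (2022) e110 [CastellaLiuWan2022]
  Thm. 8.2.3, whose statement does NOT match JSW's §6.1 theorem verbatim (referee R123.1: Δ1 "if `2`
  does not split in `𝒦` then `π` ramified at `2`" absent from JSW's (a)–(d); Δ2 ring `𝔭ℛ` vs
  `Λ[1/p]`) and which carries the travelling flag `Hid04-gap` (authors' unrefereed 2024 addendum after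
  the [Hid04, Thm. 3.2] gap), as does its E-level form Castella–Wan, Math. Ann. 389 (2024) Thm. 5.3
  [CastellaWan2023] (this seat's CASTELLA-WAN.md §8 reads Δ1/Δ2 against that refereed text, for the
  referee) —, the anticyclotomic control theorem, Brooks' `p`-adic Waldspurger formula, Burungale's
  `μ = 0`, the general Gross–Zagier formula, and "Kato has proved that the predicted upper bound holds
  for `#Ш(E^{D'}/ℚ)[p^∞]`" (Thm. 7.2.1 (i), [perrin-riou:expmath]) for the FIRST auxiliary twist; so
  at a supersingular `p` the (α)-step is NOT a published input under the cell's rule — which is exactly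
  why this file takes it as the TYPED input STEP L (`hL`) and books nothing;
* §7.4.2 proves the UPPER bound (eq:shaupper) from Kolyvagin + Gross–Zagier + the rank-`0` `p`-part
  EQUALITY for the SECOND auxiliary twist `E^{D''}` (Thm. 7.2.1 (iii): "[wan:kobayashi] for the
  supersingular case") — this is where, and ONLY where, component (β) = [wan:kobayashi] → BSTW
  Thm. 1.5 (PRE) enters (§1.3: "It is only at the final step, where we invoke the `p`-part of the
  BSD formula for `L(E^{D''},1)` …"; §7.4.4 (iii)).

The cell ALREADY has the upper half on X6 ∧ {r_an = 1} at every odd `p` from refereed print that is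
`JSW-ss`-free: Sprung, Adv. Math. 449 (2024) Cor. 1.3, second sentence (tree fact
`Sprung2024.cor13_padicValRat_bsd_rank_one_le`, flags `Sprung24-Cor13-via-Kob13` /
`KOB13-primary-unread`; `Supersingular/X6RankOneOneSided.lean`: the typed residue on X6 ∧ {r_an = 1}
IS `Typed.MissingLowerBoundAt W p`, `X6.bsdp_of_missingLowerBoundAt_of_analyticRank_eq_one`).

THIS FILE: the lower half re-derived in the kernel from STEP L at a good SUPERSINGULAR `p ≥ 5`. For
an X6 pair in analytic rank `1` and a Manin-unit Heegner datum over an imaginary quadratic `K` with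
every `ℓ ∣ N` split and `p` split (`L(E^{d_K},1) ≠ 0`): STEP L (`X11b.IndexLowerBoundAt W p K P`, the
multr1 seats' typed input = JSW (eq:shalowerK-1) "control + ONE divisibility of the anticyclotomic
main conjecture + BDP"; in print at a good `p` from (α) for JSW's `K'` with a NON-split `q ∣ N`, NOT
for the all-split `K` of the binder — the cell lead's currency caveat C186, exactly as in the GLUE
seat's ordinary row-C3 file) + Wuthrich 2014 Prop. 21 for the twist (the twist model is GOOD at `p`
— `good_twist_model`, `p ∤ 2 d_K` — and has surjective `ρ̄` because `E` does, AUTOMATIC on X6: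
`ClassX6.surj` + `X11b.surj_twist_model`) + Gross–Zagier + Kolyvagin (qualitative) ⇒
`Typed.MissingLowerBoundAt W p` (`X6.missingLowerBoundAt_of_indexLowerBoundAt`, datum level;
`X6.missingLowerBoundAt_of_stepL`, class level with the field from Friedberg–Hoffstein and the datum
from `X11b.exists_maninDatum_of_good`); with Sprung: `BSDp W p` (`X6.bsdp_of_stepL_of_sprung`).
This is multr1-p2's `X11b.missingLowerBoundAt_of_indexLowerBoundAt_of_surj` (at `p ∥ N`) and the
GLUE seat's `X11b.bsdp_rankOne_of_indexLowerBoundAt_of_goodOrd_twist` (good ORDINARY `p`) carried to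
a good SUPERSINGULAR `p`: the supersingular sub-row of C3 that
`Partition/MainConjecturesAnticyclotomicClass.lean` left untouched ("The supersingular sub-case of C3
(flag `JSW-ss`) … NOT touched"). NO rank-`0` `p`-part EQUALITY for any twist is consumed (no
[wan:kobayashi] / BSTW, no Skinner–Urban): only Wuthrich's published `≤`-half — which is why, at a
supersingular `p`, STEP L is the ONLY non-published input of `BSD(E,p)` on X6 ∧ {r_an = 1} ∧ {p ≥ 5}
along this route. The companion file `Supersingular/X6RankOneJSWLowerBound.lean` takes instead
JSW's own (eq:shalower) as a cited named fact (`JetchevSkinnerWan2017.sec741_shaLowerBound_rank_one`).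

References: Jetchev–Skinner–Wan 2017 §1.3, §7.2 Thm. 7.2.1, §7.4.1–7.4.4 [JetchevSkinnerWan2017];
Sprung 2024 Cor. 1.3 [Sprung2024]; Wuthrich 2014 Prop. 21 [Wuthrich2014]; Castella–Liu–Wan 2022
Thm. 8.2.3 [CastellaLiuWan2022]; Castella–Wan 2024 Thm. 5.3 [CastellaWan2023]; Perrin-Riou 2003
[PerrinRiou2003]; Burungale–Skinner–Tian–Wan arXiv:2409.01350 Thms. 1.3/1.5
[BurungaleSkinnerTianWan2024, PRE]; Serre 1972 Props. 12, 21 [Serre1972]; Silverman AEC VII.5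
Prop. 5.1, VIII.8 Cor. 8.3 [SilvermanAEC2009]; Friedberg–Hoffstein 1995 [FriedbergHoffstein1995];
Mazur 1978 Cor. 4.1 [Mazur1978]; Miller 2011 Def. 1.1 [Miller2011LMS].
-/

set_option autoImplicit false

noncomputable section

open scoped Classical MatrixGroups ModularForm

open CongruenceSubgroup WeierstrassCurve NumberField Literature.NumberTheory.EllipticCurves
  Literature.NumberTheory.EllipticCurves.ModularForms
  Literature.NumberTheory.EllipticCurves.Rank1Residual
  Literature.NumberTheory.EllipticCurves.Rank1Residual.Typed
  Literature.NumberTheory.EllipticCurves.Wuthrich2014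

namespace Summit.BirchSwinnertonDyer.Rank1Residual.Supersingular

/-! ### §1 The twist at a good prime: Wuthrich's `≤`-half and good reduction -/

/-- **The `≤`-half of the rank-`0` `p`-part at a GOOD odd prime with surjective `ρ̄`, from Wuthrich
2014 Prop. 21** — the good-reduction twin of multr1-p2's `X11b.twist_le_half_of_wuthrich`
(multiplicative `p`). For `Wd/ℚ` globally minimal with `L(E^D,1) ≠ 0`, `p` odd, `Wd` good at `p`
(hence not additive) and `ρ̄_{E^D,p}` onto: `L(E^D,1)/Ω = q ∈ ℚ` with
`ord_p #Ш(E^D) + ord_p ∏_ℓ c_ℓ(E^D) − 2·ord_p #E^D(ℚ)_tors ≤ ord_p q` — the hypothesis `htw` of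
`X11b.missingLowerBoundAt_of_indexLowerBoundAt` (JSW Thm. 7.2.1 (i), "Kato … [perrin-riou:expmath]").
[cite: Wuthrich2014, Prop. 21 (p. 400)] [cite: JetchevSkinnerWan2017, §7.2 Thm. 7.2.1 (i)] -/
theorem twist_le_half_of_wuthrich_good (hWu : sha_dvd_analyticSha)
    (hGZK : rank_eq_analyticRank_of_analyticRank_le_one) (hmod : hasEntireLFunction_rat)
    (Wd : WeierstrassCurve ℚ) [Wd.IsElliptic] [Wd.IsGloballyMinimal] (p : ℕ) [Fact p.Prime]
    (hp2 : p ≠ 2) (hL1 : Wd.entireLFunction 1 ≠ 0) (hgood : Wd.HasGoodReductionAtPrime p)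
    (hsurj : Wd.HasSurjectiveModNGaloisRep p) :
    ∃ q : ℚ, Wd.entireLFunction 1 / (Wd.realPeriodRat : ℂ) = (q : ℂ) ∧
      (padicValNat p Wd.shaOrder : ℤ) + padicValNat p Wd.tamagawaProduct -
        2 * padicValNat p Wd.torsionOrder ≤ padicValRat p q := by
  have hrd : Wd.analyticRank = 0 := (Wd.analyticRank_eq_zero_iff_holds (hmod Wd)).2 hL1
  obtain ⟨hrank, hfin⟩ := hGZK Wd (by omega)
  have hmw0 : Wd.mordellWeilRank = 0 := by omega
  haveI hE : Finite Wd.toAffine.Point := Wd.finite_point_of_rank_zero hmw0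
  obtain ⟨q, hq, hq0, hle⟩ := padicValNat_shaOrder_le_of_sha_dvd hWu Wd p hp2 hL1 hE hfin
    (WeierstrassCurve.HasGoodReduction.not_hasAdditiveReduction (R := ℤ_[p]) hgood) (Or.inr hsurj)
  refine ⟨q, hq, ?_⟩
  have ht0 : (Wd.torsionOrder : ℚ) ≠ 0 := by exact_mod_cast (Wd.torsionOrder_pos_holds).ne'
  have hc0 : (Wd.tamagawaProduct : ℚ) ≠ 0 := by exact_mod_cast (Wd.tamagawaProduct_pos').ne'
  rw [Wd.natCard_point_eq_torsionOrder] at hle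
  have h2 : padicValRat p (q * (Wd.torsionOrder : ℚ) ^ 2 / (Wd.tamagawaProduct : ℚ)) =
      padicValRat p q + 2 * (padicValNat p Wd.torsionOrder : ℤ) -
        (padicValNat p Wd.tamagawaProduct : ℤ) := by
    rw [padicValRat.div (mul_ne_zero hq0 (pow_ne_zero 2 ht0)) hc0,
      padicValRat.mul hq0 (pow_ne_zero 2 ht0), padicValRat.pow (Wd.torsionOrder : ℚ),
      padicValRat.of_nat, padicValRat.of_nat]
    push_cast
    ring
  rw [h2] at hle
  linarith

/-- **A globally minimal model of the twist `E^{(d)}` is GOOD at every odd good prime `p ∤ d` of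
`E`** (reduction-type-agnostic; the GLUE seat's `X11b.goodOrd_twist_model` is the ordinary case with
`a_p`). At the place `v` of `ℤ` over `p`, `d` and `2` are `v`-units, so `E^{(d)}` and `E` have the
same reduction type at `v` (tree theorem `hasReductionAt_quadraticTwist_iff_of_not_dvd`, Silverman
AEC VII.5 Prop. 5.1 / VII.1 Prop. 1.3(b)); prime-indexed ↔ place-indexed by
`hasGoodReductionAtPrime_iff_hasGoodReductionAt_holds`; good reduction is an isomorphism invariant
(`hasGoodReductionAtPrime_iff_of_variableChange`). [cite: SilvermanAEC2009, VII.5 Prop. 5.1(a) and VII.1 Prop. 1.3(b)] -/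
theorem good_twist_model (W : WeierstrassCurve ℚ) [W.IsElliptic] [W.IsGloballyMinimal] (p : ℕ)
    [Fact p.Prime] (hp2 : p ≠ 2) {d : ℤ} (hpd : ¬ (p : ℤ) ∣ d) (hgood : W.HasGoodReductionAtPrime p)
    {Wd : WeierstrassCurve ℚ} (Cd : VariableChange ℚ) (hWd : Cd • W.quadraticTwist (d : ℚ) = Wd) :
    Wd.HasGoodReductionAtPrime p := by
  have hp : p.Prime := Fact.out
  set v : IsDedekindDomain.HeightOneSpectrum ℤ :=
    (Rat.HeightOneSpectrum.primesEquiv (R := ℤ)).symm ⟨p, hp⟩ with hv_def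
  have hv : Rat.HeightOneSpectrum.natGenerator v = p :=
    congrArg Subtype.val ((Rat.HeightOneSpectrum.primesEquiv (R := ℤ)).apply_symm_apply ⟨p, hp⟩)
  have hv2 : Rat.HeightOneSpectrum.natGenerator v ≠ 2 := by rw [hv]; exact hp2
  have hvd : ¬ ((Rat.HeightOneSpectrum.natGenerator v : ℕ) : ℤ) ∣ d := by rw [hv]; exact hpd
  -- `W` good at `v`; the twist good at `v`; back to the prime-indexed predicate; along `Cd`
  have hWv : W.HasGoodReductionAt v :=
    (W.hasGoodReductionAtPrime_iff_hasGoodReductionAt_holds ⟨p, hp⟩).mp hgood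
  have htv : (W.quadraticTwist (d : ℚ)).HasGoodReductionAt v :=
    (W.hasReductionAt_quadraticTwist_iff_of_not_dvd v hv2 hvd).1.mpr hWv
  have htp : (W.quadraticTwist (d : ℚ)).HasGoodReductionAtPrime p :=
    ((W.quadraticTwist (d : ℚ)).hasGoodReductionAtPrime_iff_hasGoodReductionAt_holds ⟨p, hp⟩).mpr htv
  rw [← hWd, hasGoodReductionAtPrime_iff_of_variableChange]
  exact htp

/-! ### §2 STEP L ⇒ the lower half on X6 ∧ {r_an = 1} ∧ {p ≥ 5}; with Sprung, `BSD(E,p)` -/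

/-- **STEP L ⇒ the typed lower bound on X6 ∧ {r_an = 1}, at fixed Heegner data, good supersingular
`p ≥ 5`** — the kernel form of JSW §7.4.1's descent at a supersingular prime. Data: `W/ℚ` globally
minimal of conductor `N` in `ClassX6 W p`, `ord_{s=1} L(E,s) = 1`, `p ≥ 5`; `K` imaginary quadratic
with EVERY `ℓ ∣ N` split and `p` split; a parametrisation datum `Dt` at level `N` with `p ∤ c(Dt)`,
its Heegner point `P` (`hP`), `p ∤ #𝓞_K^×`, `L(E^{d_K},1) ≠ 0`, a globally minimal model
`Wd = Cd • E^{(d_K)}`. PUBLISHED inputs by name: Gross–Zagier (`hGZ`), Kolyvagin (`hKo`,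
qualitative), Wuthrich 2014 Prop. 21 (`hWu`, for the twist: GOOD at `p` by `good_twist_model`,
`p ∤ d_K` from `p` split; `ρ̄_{E^{d_K},p}` onto because `ρ̄_{E,p}` is — AUTOMATIC on X6, Serre
Props. 12 + 21: `ClassX6.surj`, `X11b.surj_twist_model`), GZK (`hGZK`), modularity (`hmod`); the
transports `X11b.padicValNat_tamagawaProduct_twist_of_heegner` ((eq:tamK), `p ≥ 5`),
`X11b.padicValRat_u_eq_zero_of_twist_good`. TYPED input: STEP L `hL : X11b.IndexLowerBoundAt W p K P`
(JSW (eq:shalowerK-1); in print at good `p` from (α) + control + Brooks/BDP for JSW's `K'` with a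
NON-split prime of `N` — for the all-split `K` of this binder a typed input, cell-lead caveat C186).
CONCLUSION: `Typed.MissingLowerBoundAt W p`. No rank-`0` `p`-part EQUALITY for the twist is used.
[cite: JetchevSkinnerWan2017, §7.4.1 (eq:shalowerK-1)–(eq:shalower), pp. 30–31 of arXiv:1512.06894]
[cite: Wuthrich2014, Prop. 21 (p. 400)] [cite: Serre1972, §1.11 Prop. 12 and §5.4 Prop. 21]
[cite: Miller2011LMS, Def. 1.1] -/
theorem X6.missingLowerBoundAt_of_indexLowerBoundAt
    (W : WeierstrassCurve ℚ) [W.IsElliptic] [W.IsGloballyMinimal] (p : ℕ) [Fact p.Prime]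
    [NeZero (W.conductorNorm ℤ)] (K : Type) [Field K] [NumberField K]
    (Dt : ModularParametrizationData W (W.conductorNorm ℤ))
    (H : HeegnerDatum (W.conductorNorm ℤ) (NumberField.discr K)) (ι : K →+* ℂ)
    (P : (W.baseChange K).toAffine.Point)
    -- the published inputs (named facts of the tree)
    (hGZ : gross_zagier (W.conductorNorm ℤ) W K) (hKo : kolyvagin (W.conductorNorm ℤ) W K)
    (hWu : sha_dvd_analyticSha)
    (hGZK : rank_eq_analyticRank_of_analyticRank_le_one) (hmod : hasEntireLFunction_rat)
    -- the pair
    (hX : ClassX6 W p) (hr : W.analyticRank = 1) (hp5 : 5 ≤ p)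
    -- the Heegner data
    (hK : IsImaginaryQuadratic K) (hHN : SatisfiesHeegnerHypothesis (W.conductorNorm ℤ) K)
    (hHp : SatisfiesHeegnerHypothesis p K)
    (hP : WeierstrassCurve.Affine.Point.map ι.toRatAlgHom P = heegnerPointComplex Dt H)
    (hc : ¬ (p : ℤ) ∣ Dt.c) (hμ : ¬ p ∣ Units.torsionOrder K)
    (hLt : (W.quadraticTwist (NumberField.discr K : ℚ)).entireLFunction 1 ≠ 0)
    (Wd : WeierstrassCurve ℚ) [Wd.IsElliptic] [Wd.IsGloballyMinimal] (Cd : VariableChange ℚ)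
    (hWd : Cd • W.quadraticTwist (NumberField.discr K : ℚ) = Wd)
    -- STEP L (the typed input)
    (hL : X11b.IndexLowerBoundAt W p K P) :
    MissingLowerBoundAt W p := by
  have hp : p.Prime := Fact.out
  have hp2 : p ≠ 2 := by omega
  have hD0 : (NumberField.discr K : ℚ) ≠ 0 := by exact_mod_cast NumberField.discr_ne_zero K
  haveI hEt : (W.quadraticTwist (NumberField.discr K : ℚ)).IsElliptic :=
    W.isElliptic_quadraticTwist hD0
  have hgood : W.HasGoodReductionAtPrime p := hX.1.1
  have hsurj : Surj W p := ClassX6.surj W p hp2 hX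
  -- `p ∤ d_K` (`p` splits in `K`)
  have hpd : ¬ (p : ℤ) ∣ NumberField.discr K :=
    Literature.SatisfiesHeegnerHypothesis.not_dvd_discr hK.1 hHp hp dvd_rfl
  -- transports to the minimal twist model: good at `p`, surjective image, Tamagawa valuation, unit
  have hgoodd : Wd.HasGoodReductionAtPrime p := good_twist_model W p hp2 hpd hgood Cd hWd
  have hsurjd : Surj Wd p := X11b.surj_twist_model W p K hsurj Cd hWd
  have htam : padicValNat p Wd.tamagawaProduct = padicValNat p W.tamagawaProduct :=
    X11b.padicValNat_tamagawaProduct_twist_of_heegner W p hp5 K hK hHN Cd hWd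
  have hu : padicValRat p (Cd.u : ℚ) = 0 :=
    X11b.padicValRat_u_eq_zero_of_twist_good W p hpd hgood Cd hWd hgoodd
  -- the twist: `L(E^D,1) ≠ 0` and Wuthrich's `≤`-half
  have hLt' : (W.quadraticTwist (NumberField.discr K : ℚ)).entireLFunction = Wd.entireLFunction := by
    rw [← hWd, entireLFunction_smul]
  have hLd1 : Wd.entireLFunction 1 ≠ 0 := by rw [← hLt']; exact hLt
  have htw := twist_le_half_of_wuthrich_good hWu hGZK hmod Wd p hp2 hLd1 hgoodd hsurjd
  exact X11b.missingLowerBoundAt_of_indexLowerBoundAt W p (W.conductorNorm ℤ) K Dt H ι P hGZ hKo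
    hGZK hmod hK hHN hP hp2 hc hμ hr hLt Wd Cd hWd hu htam htw (fun _ ↦ hL)

/-- **STEP L ⇒ the typed lower bound on the whole of X6 ∧ {r_an = 1} ∧ {p ≥ 5}** (class level; the
field and the datum discharged as in the GLUE seat's row-C3 file). For every X6 pair with
`ord_{s=1} L(E,s) = 1` and `p ≥ 5`: the sign is `−1` (modularity `hnf`); Friedberg–Hoffstein (`hFH`)
gives an imaginary quadratic `K` with every `ℓ ∣ N` split, `p` split, `|d_K| > 4` (so
`#𝓞_K^× = 2` is prime to `p`) and `L(E^{d_K},1) ≠ 0`; `X11b.exists_maninDatum_of_good` (`hnf`, Mazur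
1978 Cor. 4.1 `hMaz`, the Néron mapping property `hNS`; `E[p]` irreducible is AUTOMATIC,
`ClassX6.irr`) gives a datum with `p ∤ c` and its Heegner point; a globally minimal model of the
twist exists (AEC VIII.8.3). Then `X6.missingLowerBoundAt_of_indexLowerBoundAt`. TYPED input: STEP L
at every such datum (`hL`). CONCLUSION: `ord_p #Ш(E)_an ≤ ord_p #Ш(E)`. CONDITIONAL on STEP L;
nothing booked. [cite: JetchevSkinnerWan2017, §7.4.1 (pp. 29–31 of arXiv:1512.06894)]
[cite: Wuthrich2014, Prop. 21 (p. 400)] [cite: Mazur1978, Cor. 4.1] [cite: Miller2011LMS, Def. 1.1] -/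
theorem X6.missingLowerBoundAt_of_stepL
    -- published inputs (named facts of the tree)
    (hGZ : ∀ (N : ℕ) [NeZero N] (W : WeierstrassCurve ℚ) (K : Type) [Field K] [NumberField K],
      gross_zagier N W K)
    (hKo : ∀ (N : ℕ) [NeZero N] (W : WeierstrassCurve ℚ) (K : Type) [Field K] [NumberField K],
      kolyvagin N W K)
    (hWu : sha_dvd_analyticSha)
    (hGZK : rank_eq_analyticRank_of_analyticRank_le_one) (hmod : hasEntireLFunction_rat)
    (hnf : exists_isNewformOf)
    (hFH : friedbergHoffstein_exists_heegnerField_split_twist_ne_zero)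
    (hMaz : mazur_not_dvd_maninConstant_of_odd) (hNS : integral_neronScaling_of_isGloballyMinimal)
    -- the typed input (STEP L) at every Manin-unit Heegner datum with `p` split in `K`
    (hL : ∀ (W : WeierstrassCurve ℚ) [W.IsElliptic] [W.IsGloballyMinimal] (p : ℕ) [Fact p.Prime]
      (N : ℕ) [NeZero N] (K : Type) [Field K] [NumberField K]
      (Dt : ModularParametrizationData W N) (H : HeegnerDatum N (NumberField.discr K)) (ι : K →+* ℂ)
      (P : (W.baseChange K).toAffine.Point),
      ClassX6 W p → 5 ≤ p → W.analyticRank = 1 → W.conductorNorm ℤ = N → IsImaginaryQuadratic K →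
      SatisfiesHeegnerHypothesis N K → SatisfiesHeegnerHypothesis p K →
      WeierstrassCurve.Affine.Point.map ι.toRatAlgHom P = heegnerPointComplex Dt H →
      ¬ (p : ℤ) ∣ Dt.c → X11b.IndexLowerBoundAt W p K P) :
    ∀ (W : WeierstrassCurve ℚ) [W.IsElliptic] [W.IsGloballyMinimal] (p : ℕ) [Fact p.Prime],
      ClassX6 W p → 5 ≤ p → W.analyticRank = 1 → MissingLowerBoundAt W p := by
  intro W _ _ p _ hX hp5 hr
  have hp : p.Prime := Fact.out
  have hp2 : p ≠ 2 := by omega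
  have hgood : W.HasGoodReductionAtPrime p := hX.1.1
  have hirr : Irr W p := ClassX6.irr W p hp2 hX
  haveI : NeZero (W.conductorNorm ℤ) := ⟨(W.conductorNorm_pos_holds).ne'⟩
  -- the sign of the functional equation is `−1` (modularity, `r_an = 1`)
  have hw : W.rootNumber = -1 := by
    rw [WeierstrassCurve.rootNumber_eq_neg_one_pow_analyticRank_of_exists_isNewformOf hnf W, hr]
    norm_num
  -- the auxiliary field (Friedberg–Hoffstein): every `ℓ ∣ N` split, `p` split, `|d_K| > 4`,
  -- `L(E^{d_K},1) ≠ 0`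
  obtain ⟨K, _, _, hK, hdisc, hHN, hHp, hLt⟩ := hFH W hw p hp 4
  -- `w_K = 2`, prime to `p ≥ 5`
  have hμ : ¬ p ∣ Units.torsionOrder K := by
    haveI : IsTotallyComplex K := hK.2
    have hneg : NumberField.discr K < 0 := discr_neg_of_finrank_eq_two K hK.1
    have habs : ((NumberField.discr K).natAbs : ℤ) = -NumberField.discr K :=
      Int.ofNat_natAbs_of_nonpos hneg.le
    have h4 : NumberField.discr K < -4 := by
      have : (4 : ℤ) < ((NumberField.discr K).natAbs : ℤ) := by exact_mod_cast hdisc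
      omega
    rw [Literature.NumberTheory.DiophantineGeometry.torsionOrder_eq_two_of_discr_lt hK.1 h4]
    intro h2
    have := Nat.le_of_dvd two_pos h2
    omega
  -- the Manin-unit Heegner datum at a good odd prime
  obtain ⟨Dt, H, ι, P, hP, hc⟩ :=
    X11b.exists_maninDatum_of_good hnf hMaz hNS W p (W.conductorNorm ℤ) K rfl hp2 hgood hirr hK hHN
  -- a globally minimal model of the twist (Silverman VIII.8 Cor. 8.3)
  have hD0 : (NumberField.discr K : ℚ) ≠ 0 := by exact_mod_cast NumberField.discr_ne_zero K
  haveI hEt : (W.quadraticTwist (NumberField.discr K : ℚ)).IsElliptic :=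
    W.isElliptic_quadraticTwist hD0
  obtain ⟨Cd, hCd⟩ := hasGlobalMinimalModel_rat_holds (W.quadraticTwist (NumberField.discr K : ℚ))
  haveI : (Cd • W.quadraticTwist (NumberField.discr K : ℚ)).IsGloballyMinimal := hCd
  have hWd : Cd • W.quadraticTwist (NumberField.discr K : ℚ) =
      Cd • W.quadraticTwist (NumberField.discr K : ℚ) := rfl
  exact X6.missingLowerBoundAt_of_indexLowerBoundAt W p K Dt H ι P (hGZ _ W K) (hKo _ W K) hWu hGZK
    hmod hX hr hp5 hK hHN hHp hP hc hμ hLt (Cd • W.quadraticTwist (NumberField.discr K : ℚ)) Cd hWd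
    (hL W p _ K Dt H ι P hX hp5 hr rfl hK hHN hHp hP hc)

/-- **STEP L + Sprung 2024 Cor. 1.3 (ii) ⇒ `BSD(E,p)` on X6 ∧ {r_an = 1} ∧ {p ≥ 5}.** The lower half
from STEP L (`X6.missingLowerBoundAt_of_stepL`: anticyclotomic input typed, everything else
published by name), the upper half from Sprung's Cor. 1.3 second sentence (`hS`). CONDITIONAL on
STEP L and the named facts; X6's label is the referee's. [cite: Sprung2024, Cor. 1.3 (p. 5), second sentence]
[cite: JetchevSkinnerWan2017, §7.4.1 (pp. 29–31 of arXiv:1512.06894)] [cite: Miller2011LMS, §1 and Def. 1.1] -/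
theorem X6.bsdp_of_stepL_of_sprung
    (hGZ : ∀ (N : ℕ) [NeZero N] (W : WeierstrassCurve ℚ) (K : Type) [Field K] [NumberField K],
      gross_zagier N W K)
    (hKo : ∀ (N : ℕ) [NeZero N] (W : WeierstrassCurve ℚ) (K : Type) [Field K] [NumberField K],
      kolyvagin N W K)
    (hWu : sha_dvd_analyticSha) (hS : Sprung2024.cor13_padicValRat_bsd_rank_one_le)
    (hGZK : rank_eq_analyticRank_of_analyticRank_le_one) (hmod : hasEntireLFunction_rat)
    (hnf : exists_isNewformOf)
    (hFH : friedbergHoffstein_exists_heegnerField_split_twist_ne_zero)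
    (hMaz : mazur_not_dvd_maninConstant_of_odd) (hNS : integral_neronScaling_of_isGloballyMinimal)
    (hL : ∀ (W : WeierstrassCurve ℚ) [W.IsElliptic] [W.IsGloballyMinimal] (p : ℕ) [Fact p.Prime]
      (N : ℕ) [NeZero N] (K : Type) [Field K] [NumberField K]
      (Dt : ModularParametrizationData W N) (H : HeegnerDatum N (NumberField.discr K)) (ι : K →+* ℂ)
      (P : (W.baseChange K).toAffine.Point),
      ClassX6 W p → 5 ≤ p → W.analyticRank = 1 → W.conductorNorm ℤ = N → IsImaginaryQuadratic K →
      SatisfiesHeegnerHypothesis N K → SatisfiesHeegnerHypothesis p K →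
      WeierstrassCurve.Affine.Point.map ι.toRatAlgHom P = heegnerPointComplex Dt H →
      ¬ (p : ℤ) ∣ Dt.c → X11b.IndexLowerBoundAt W p K P)
    (W : WeierstrassCurve ℚ) [W.IsElliptic] [W.IsGloballyMinimal] (p : ℕ) [Fact p.Prime]
    (hX : ClassX6 W p) (hp5 : 5 ≤ p) (hr : W.analyticRank = 1) : BSDp W p :=
  X6.bsdp_of_missingLowerBoundAt_of_analyticRank_eq_one W p hS hGZK hmod (by omega) hX hr
    (X6.missingLowerBoundAt_of_stepL hGZ hKo hWu hGZK hmod hnf hFH hMaz hNS hL W p hX hp5 hr)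

end Summit.BirchSwinnertonDyer.Rank1Residual.Supersingular

end
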